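import Literature.InformationTheory.QuantumCodes.ToricCodeCycles
import Literature.InformationTheory.QuantumCodes.SyndromeDecodingCSSPauli
import Literature.InformationTheory.QuantumCodes.CSSEquivalence
import HarnessLib

/-!
# The `Z`-distance of the `L × L` toric code is exactly `L`; minimum-weight (MWPM) decoding corrects exactly
# `⌊(L−1)/2⌋` phase-flip errors, and no decoder corrects more — for every `L ≥ 1`

Topic `InformationTheory/QuantumCodes`; namespace `Literature.InformationTheory.QuantumCodes.ToricCode` (the objects of
`ToricCodeThreshold.lean`: `Chain L`, `syn L`, `cycles L`, `boundaries L`, `toricCode L`, `ZDecoder L`). Theorem-and-two-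
definitions file, all PROVED, 0 facts (qec PARTITION row 08, Q4 «method = theorem» for a FAMILY).

* `rowLoop L` — the horizontal non-contractible loop (all direction-`0` links at height `0`), a cycle (`rowLoop_mem_cycles`)
  of weight `≤ L` that is NOT a boundary (`rowLoop_not_mem_boundaries`): the witness is the vertical cut `colCut L` (all
  direction-`0` links in column `0`), which meets every plaquette evenly (`plaquetteMatrix_mulVec_colCut`) and the loop
  once (`colCut_dotProduct_rowLoop`) — Dennis–Kitaev–Landahl–Preskill §3.1 (chunk p0008): "a cycle could be homologically nontrivial, that is, not the
  boundary of anything".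
* `toricCode_dZ : (toricCode L).dZ = L` — with lit-2's lower bound `cycle_weight_ge_holds` ("the homologically nontrivial
  path must contain at least `L` links", §5.2) this is the exact `Z`-distance of the toric code, for every `L ≥ 1` (§3.1 chunk p0008 L5: "the code
  distance is d=L").
* `minWeight_isCorrectionRadius` — EVERY minimum-weight `Z`-decoder (`D.IsMinWeight (syn L) (cycles L) hammingNorm`; e.g.
  minimum-weight perfect matching, §5.1 "E_min … Edmonds") corrects every `Z`-error chain with at most `⌊(L−1)/2⌋` links and
  fails on some chain with one more; `optimalRadiusZ` — and NO decoder of the star syndrome whatsoever corrects every chain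
  of `⌊(L−1)/2⌋ + 1` links (Gottesman §2.3), so `⌊(L−1)/2⌋` is the optimal guaranteed-correction radius of the toric code
  against phase flips, attained. (Adversarial radius; the PROBABILISTIC statement — threshold — is `ToricCodeThreshold*`.)
* (appended) LATTICE DUALITY `dualEdge` — `plaquetteMatrix = starMatrix.submatrix neg dualEdge` and conversely, so the
  `X`/`Z`-exchanged toric code is the toric code re-indexed (type-05's FACT P, `CSSCode.dZ_eq_of_submatrix`):
  `toricCode_dX : (toricCode L).dX = L`, an `X`-logical (`colCut`), and `optimalRadiusX` — the optimal BIT-FLIP radius is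
  `⌊(L−1)/2⌋` as well, attained by minimum-weight decoding of the plaquette syndrome.

## References
* [DennisEtAl2002] E. Dennis, A. Kitaev, A. Landahl, J. Preskill, *Topological quantum memory*, J. Math. Phys. 43 (2002),
  arXiv:quant-ph/0110143, §3.1 (held chunk p0008 L1–5: trivial/nontrivial cycles, encoded Z̄/X̄, "the code distance is d=L",
  "weight less than half the code distance … recover … by applying the minimal weight Pauli operator"), §5.1–5.2 (E_min; ≥ L links).
* [Gottesman1997] D. Gottesman, PhD thesis, arXiv:quant-ph/9705052, §2.3 (chunk p0014 L3: distance ≥ 2t+1).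
* [DelfosseNickerson2021] N. Delfosse, N. H. Nickerson, Quantum 5 (2021) 595, §3 ¶2 (min-weight decoding: (d−1)/2, tight).
-/

namespace Literature.InformationTheory.QuantumCodes

open Finset Matrix

namespace ToricCode

variable {L : ℕ}

/-! ## A non-contractible loop and its dual cut -/

/-- The **horizontal non-contractible loop** at height `0`: the chain carrying `1` on every direction-`0` link `(v, 0)`
with `v 1 = 0` ("a cycle that wraps around the torus"). (definition) [cite: DennisEtAl2002, §3.1 (chunk p0008 L3: "a cycle could be homologically nontrivial, that is, not the boundary of anything … the two fundamental nontrivial cycles of the torus")] -/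
def rowLoop (L : ℕ) : Chain L := fun ℓ => if ℓ.2 = 0 ∧ ℓ.1 1 = 0 then 1 else 0

/-- The **vertical cut** through column `0`: the chain carrying `1` on every direction-`0` link `(v, 0)` with `v 0 = 0`
(the links crossed by a non-contractible loop of the dual lattice). (definition) [cite: DennisEtAl2002, §3.1 (chunk p0008 L3: "Associated with the two dual cycles of the dual lattice are the corresponding encoded operations X̄₁ and X̄₂")] -/
def colCut (L : ℕ) : Chain L := fun ℓ => if ℓ.2 = 0 ∧ ℓ.1 0 = 0 then 1 else 0

/-- In `ℤ₂`, `a + a = 0`. [folklore] -/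
private theorem zmod2_add_self' (a : ZMod 2) : a + a = 0 := by
  revert a; decide

/-- The horizontal loop has no boundary: every site meets it in `0` or `2` links. [cite: DennisEtAl2002, §3.1 (chunk p0008 L3: a nontrivial cycle "commutes with the code stabilizer (because it is a cycle)")] -/
theorem rowLoop_mem_cycles [NeZero L] : rowLoop L ∈ cycles L := by
  show syn L (rowLoop L) = 0
  funext s
  rw [syn, starMatrix_mulVec_apply]
  simp only [rowLoop, Fin.isValue, Pi.sub_apply, dir, Pi.single_apply, Pi.zero_apply]
  simp only [Fin.isValue, one_ne_zero, if_false, sub_zero, false_and, add_zero, true_and]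
  exact zmod2_add_self' _

/-- The plaquette syndrome at a plaquette is the sum of the four boundary link values:
`(H^Z u)_w = u(w,0) + u(w,1) + u(w+e₁,0) + u(w+e₀,1)`. [cite: DennisEtAl2002, §3.1 (Z_P = ⊗_{ℓ ∈ P} Z_ℓ)] -/
theorem plaquetteMatrix_mulVec_apply [NeZero L] (u : Chain L) (w : Vertex L) :
    (plaquetteMatrix L *ᵥ u) w = u (w, 0) + u (w, 1) + u (w + dir 1, 0) + u (w + dir 0, 1) := by
  change plaquetteRow w ⬝ᵥ u = _
  simp only [plaquetteRow, add_dotProduct, single_dotProduct, one_mul]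

/-- The vertical cut meets every plaquette evenly: `H^Z · colCut = 0` (it commutes with every `Z`-check).
[cite: DennisEtAl2002, §3.1 (chunk p0008 L1–3: cycles of the dual lattice vs plaquette operators)] -/
theorem plaquetteMatrix_mulVec_colCut [NeZero L] : plaquetteMatrix L *ᵥ colCut L = 0 := by
  funext w
  rw [plaquetteMatrix_mulVec_apply]
  simp only [colCut, Fin.isValue, Pi.add_apply, dir, Pi.single_apply, Pi.zero_apply]
  simp only [Fin.isValue, zero_ne_one, if_false, add_zero, one_ne_zero, false_and, true_and]
  exact zmod2_add_self' _

/-- A site of `ℤ_L × ℤ_L` is the origin iff both coordinates vanish. [folklore] -/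
private theorem vertex_eq_zero_iff (v : Vertex L) : v = 0 ↔ v 0 = 0 ∧ v 1 = 0 := by
  constructor
  · rintro rfl; exact ⟨rfl, rfl⟩
  · rintro ⟨h0, h1⟩
    funext i
    fin_cases i
    · exact h0
    · exact h1

/-- The cut and the loop share exactly one link, `((0,0), 0)`: `⟨colCut, rowLoop⟩ = 1` in `ℤ₂`.
[cite: DennisEtAl2002, §3.1 (chunk p0008 L3: Z̄ on a nontrivial cycle and X̄ on the dual cycle act as encoded Z and X, i.e. anticommute)] -/
theorem colCut_dotProduct_rowLoop [NeZero L] : colCut L ⬝ᵥ rowLoop L = 1 := by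
  unfold dotProduct
  have h : ∀ ℓ : Edge L, colCut L ℓ * rowLoop L ℓ = if ℓ = (0, 0) then 1 else 0 := by
    intro ℓ
    obtain ⟨v, i⟩ := ℓ
    simp only [colCut, rowLoop, Fin.isValue, mul_ite, mul_one, mul_zero, Prod.mk.injEq]
    by_cases hi : i = 0
    · by_cases h0 : v 0 = 0
      · by_cases h1 : v 1 = 0
        · simp [hi, (vertex_eq_zero_iff v).2 ⟨h0, h1⟩]
        · have hv : v ≠ 0 := fun h => h1 (by rw [h]; rfl)
          simp [hi, h1, hv]
      · have hv : v ≠ 0 := fun h => h0 (by rw [h]; rfl)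
        simp [hi, h0, hv]
    · simp [hi]
  simp_rw [h]
  rw [Finset.sum_ite_eq' Finset.univ ((0 : Vertex L), (0 : Fin 2))]
  simp

/-- **The horizontal loop is homologically non-trivial**: it is not a boundary (not a product of plaquettes), witnessed by
its odd intersection with the cut (`not_mem_rowSpace_of_witness`). [cite: DennisEtAl2002, §3.1 (chunk p0008 L3: "is not contained in the stabilizer (because the cycle is nontrivial)")] -/
theorem rowLoop_not_mem_boundaries [NeZero L] : rowLoop L ∉ boundaries L := by
  show rowLoop L ∉ (rowSpace (plaquetteMatrix L) : Set (Chain L))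
  rw [SetLike.mem_coe]
  refine not_mem_rowSpace_of_witness (colCut L) plaquetteMatrix_mulVec_colCut ?_
  rw [colCut_dotProduct_rowLoop]
  exact one_ne_zero

/-- The horizontal loop has at most `L` links (its support lies in the `L` links `((a, 0), 0)`, `a ∈ ℤ_L`).
[cite: DennisEtAl2002, §3.1 (chunk p0008 L5: "the code distance is d=L")] -/
theorem hammingNorm_rowLoop_le [NeZero L] : hammingNorm (rowLoop L) ≤ L := by
  rw [hammingNorm]
  have hsub : (Finset.univ.filter fun ℓ : Edge L => rowLoop L ℓ ≠ 0) ⊆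
      Finset.univ.image fun a : ZMod L => ((Pi.single 0 a : Vertex L), (0 : Fin 2)) := by
    intro ℓ hℓ
    obtain ⟨v, i⟩ := ℓ
    simp only [Finset.mem_filter, Finset.mem_univ, true_and, rowLoop, Fin.isValue, ne_eq, ite_eq_right_iff,
      one_ne_zero, imp_false, not_not] at hℓ
    obtain ⟨hi, h1⟩ := hℓ
    refine Finset.mem_image.2 ⟨v 0, Finset.mem_univ _, ?_⟩
    simp only [Prod.mk.injEq]
    refine ⟨?_, hi.symm⟩
    funext j
    fin_cases j
    · simp
    · simp [h1]
  refine (Finset.card_le_card hsub).trans ((Finset.card_image_le).trans ?_)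
  rw [Finset.card_univ, ZMod.card]

/-- **The horizontal loop has exactly `L` links** (upper bound by its support, lower bound = lit-2's
`cycle_weight_ge_holds` since it is a non-trivial cycle). [cite: DennisEtAl2002, §3.1 (chunk p0008 L5: "the code distance is d=L"); §5.2 ("must contain at least L links")] -/
theorem hammingNorm_rowLoop [NeZero L] : hammingNorm (rowLoop L) = L :=
  le_antisymm hammingNorm_rowLoop_le (cycle_weight_ge_holds L (rowLoop L) rowLoop_mem_cycles rowLoop_not_mem_boundaries)

/-! ## The exact `Z`-distance -/

/-- **The `Z`-distance of the `L × L` toric code is exactly `L`**, for every `L ≥ 1`: the minimum weight of a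
homologically non-trivial cycle (`CSSCode.dZ` of `toricCode L` = min over `ker H^X ∖ rs H^Z`).
[cite: DennisEtAl2002, §3.1 (chunk p0008 L5: "For a toric code, the distance is the number of lattice links contained in the shortest homologically nontrivial cycle … Thus in the case of an L×L square lattice drawn on the torus, the code distance is d=L")] -/
theorem toricCode_dZ [NeZero L] : (toricCode L).dZ = L :=
  (toricCode L).dZ_eq_of_witness (v := rowLoop L) rowLoop_mem_cycles rowLoop_not_mem_boundaries hammingNorm_rowLoop
    fun w hw hw' => cycle_weight_ge_holds L w hw hw'

/-- The toric code has a `Z`-logical (the horizontal loop), in the `CSSCode` phrasing. [cite: DennisEtAl2002, §3.1 (chunk p0008 L3: encoded operations Z̄₁, Z̄₂ on the nontrivial cycles)] -/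
theorem exists_zLogical [NeZero L] :
    ∃ v : Chain L, (toricCode L).HX.mulVec v = 0 ∧ v ∉ (toricCode L).rowSpZ :=
  ⟨rowLoop L, rowLoop_mem_cycles, rowLoop_not_mem_boundaries⟩

/-! ## Decoding: the optimal phase-flip correction radius of the toric code -/

/-- **Every minimum-weight `Z`-decoder of the `L × L` toric code (e.g. minimum-weight perfect matching) has correction
radius EXACTLY `⌊(L−1)/2⌋`**: it corrects every `Z`-error chain with at most `⌊(L−1)/2⌋` links (the residual
`E + E_min` is a boundary) and fails on some chain with `⌊(L−1)/2⌋ + 1` links.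
[cite: DennisEtAl2002, §3.1 (chunk p0008 L5: "If an encoded state is damaged by the action of a Pauli operator whose weight is less than half the code distance, then we can recover from the error successfully by applying the minimal weight Pauli operator that returns the damaged state to the code subspace")] [cite: DelfosseNickerson2021, §3 ¶2 (chunk p0006 L8–13: "up to (d−1)/2 … tight")] -/
theorem minWeight_isCorrectionRadius [NeZero L] {D : ZDecoder L} (hD : D.IsMinWeight (syn L) (cycles L) hammingNorm) :
    D.IsCorrectionRadius (syn L) (boundaries L) hammingNorm ((L - 1) / 2) := by
  have h := (toricCode L).isCorrectionRadiusZ_of_isMinWeight (D := D) hD exists_zLogical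
  rwa [toricCode_dZ] at h

/-- **`⌊(L−1)/2⌋` is the optimal phase-flip correction radius of the `L × L` toric code, and it is attained**: some
decoder of the star syndrome (minimum-weight decoding) has correction radius exactly `⌊(L−1)/2⌋`, and NO decoder — no
function from star syndromes to recovery chains whatsoever — corrects every `Z`-error chain of a larger weight.
[cite: Gottesman1997, §2.3 (chunk p0014 L3: "to correct up to t errors must have distance at least 2t+1")] [cite: DelfosseNickerson2021, §3 ¶2 (chunk p0006 L8–13)] -/
theorem optimalRadiusZ [NeZero L] :
    (∃ D : ZDecoder L, D.IsCorrectionRadius (syn L) (boundaries L) hammingNorm ((L - 1) / 2)) ∧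
      ∀ (D : ZDecoder L) (t : ℕ), D.CorrectsUpTo (syn L) (boundaries L) hammingNorm t → t ≤ (L - 1) / 2 := by
  have h := (toricCode L).optimalRadiusZ exists_zLogical
  rwa [toricCode_dZ] at h

end ToricCode

end Literature.InformationTheory.QuantumCodes

/-! ## Lattice duality: the `X`-distance is `L` too, and the optimal bit-flip radius (appended) -/

namespace Literature.InformationTheory.QuantumCodes

open Finset Matrix

namespace ToricCode

variable {L : ℕ}

/-- **Lattice ↔ dual-lattice duality on the links**: `(v, i) ↦ (−v, 1−i)` (an involution). Pulling the star of the site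
`−w` back along it gives the plaquette at `w` (`plaquetteMatrix_eq_submatrix`). (definition)
[cite: DennisEtAl2002, §3.1 (chunk p0008 L1–3: cycles of the lattice / of the dual lattice; plaquette vs site operators)] -/
def dualEdge (L : ℕ) : Edge L ≃ Edge L where
  toFun ℓ := (-ℓ.1, ℓ.2.rev)
  invFun ℓ := (-ℓ.1, ℓ.2.rev)
  left_inv ℓ := by simp
  right_inv ℓ := by simp

/-- **The plaquette operators are the star operators of the dual lattice**: `H^Z(w, ℓ) = H^X(−w, δℓ)` for the duality
`δ = dualEdge` — the four links bounding the plaquette at `w` are the duals of the four links meeting the site `−w`.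
[cite: DennisEtAl2002, §3.1 (chunk p0008 L1: "a product of X's acting on links that comprise a homologically trivial cycle of the dual lattice is also a product of check operators")] -/
theorem plaquetteMatrix_eq_submatrix [NeZero L] :
    plaquetteMatrix L = (starMatrix L).submatrix (Equiv.neg (Vertex L)) (dualEdge L) := by
  ext w ℓ
  obtain ⟨v, i⟩ := ℓ
  have e0 : -v = -w - dir 0 ↔ v = w + dir 0 := by
    constructor <;> intro h
    · have := congrArg Neg.neg h; simpa [neg_sub, sub_eq_add_neg, add_comm] using this
    · subst h; abel
  have e1 : -v = -w - dir 1 ↔ v = w + dir 1 := by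
    constructor <;> intro h
    · have := congrArg Neg.neg h; simpa [neg_sub, sub_eq_add_neg, add_comm] using this
    · subst h; abel
  have r0 : (0 : Fin 2).rev = 1 := rfl
  have r1 : (1 : Fin 2).rev = 0 := rfl
  fin_cases i
  · simp [plaquetteMatrix, starMatrix, plaquetteRow, starRow, dualEdge, Pi.single_apply, e0, e1, r0]
  · simp [plaquetteMatrix, starMatrix, plaquetteRow, starRow, dualEdge, Pi.single_apply, e0, e1, r1]

/-- Dually, the star operators are the plaquette operators of the dual lattice: `H^X(s, ℓ) = H^Z(−s, δℓ)`.
[cite: DennisEtAl2002, §3.1 (chunk p0008 L1–3)] -/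
theorem starMatrix_eq_submatrix [NeZero L] :
    starMatrix L = (plaquetteMatrix L).submatrix (Equiv.neg (Vertex L)) (dualEdge L) := by
  rw [plaquetteMatrix_eq_submatrix, submatrix_submatrix]
  have h1 : ((Equiv.neg (Vertex L)) ∘ (Equiv.neg (Vertex L)) : Vertex L → Vertex L) = id := by
    funext w; simp
  have h2 : ((dualEdge L) ∘ (dualEdge L) : Edge L → Edge L) = id := by
    funext ℓ; simp [dualEdge]
  rw [h1, h2, submatrix_id_id]

/-- **The `X`-distance of the `L × L` toric code is exactly `L`** (self-duality: the `X`/`Z`-exchanged code is the toric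
code re-indexed along the lattice duality, so `d^X = d^Z`, `CSSCode.dZ_eq_of_submatrix` — type-05's FACT P).
[cite: DennisEtAl2002, §3.1 (chunk p0008 L5: "the distance is the number of lattice links contained in the shortest homologically nontrivial cycle on the lattice or dual lattice … the code distance is d=L")] -/
theorem toricCode_dX [NeZero L] : (toricCode L).dX = L := by
  have h := CSSCode.dZ_eq_of_submatrix (C := toricCode L) (C' := (toricCode L).swap) (ρX := Equiv.neg (Vertex L))
    (ρZ := Equiv.neg (Vertex L)) (σ := dualEdge L) plaquetteMatrix_eq_submatrix starMatrix_eq_submatrix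
  rw [CSSCode.dZ_swap, toricCode_dZ] at h
  exact h

/-- The toric code has an `X`-logical: the vertical cut (`H^Z · colCut = 0`, and `colCut ∉ rs H^X` witnessed by the loop).
[cite: DennisEtAl2002, §3.1 (chunk p0008 L3: encoded X̄ on the dual cycles)] -/
theorem exists_xLogical [NeZero L] :
    ∃ v : Chain L, (toricCode L).HZ.mulVec v = 0 ∧ v ∉ (toricCode L).rowSpX := by
  refine ⟨colCut L, plaquetteMatrix_mulVec_colCut, ?_⟩
  refine not_mem_rowSpace_of_witness (rowLoop L) rowLoop_mem_cycles ?_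
  rw [dotProduct_comm, colCut_dotProduct_rowLoop]
  exact one_ne_zero

/-- **`⌊(L−1)/2⌋` is also the optimal BIT-FLIP correction radius of the `L × L` toric code, and it is attained**: some
decoder of the plaquette syndrome (minimum-weight decoding on the dual lattice) has correction radius exactly `⌊(L−1)/2⌋`
for `X`-errors, and no decoder of the plaquette syndrome corrects every `X`-error chain of a larger weight.
[cite: Gottesman1997, §2.3 (chunk p0014 L3)] [cite: DennisEtAl2002, §3.1 (chunk p0008 L5: "weight less than half the code distance … recover … by applying the minimal weight Pauli operator")] -/
theorem optimalRadiusX [NeZero L] :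
    (∃ D : Decoder (Syndrome L) (Chain L),
        D.IsCorrectionRadius (toricCode L).xSyndrome ((toricCode L).rowSpX : Set (Chain L)) hammingNorm ((L - 1) / 2)) ∧
      ∀ (D : Decoder (Syndrome L) (Chain L)) (t : ℕ),
        D.CorrectsUpTo (toricCode L).xSyndrome ((toricCode L).rowSpX : Set (Chain L)) hammingNorm t → t ≤ (L - 1) / 2 := by
  have h := (toricCode L).optimalRadiusX exists_xLogical
  rwa [toricCode_dX] at h

end ToricCode

end Literature.InformationTheory.QuantumCodes
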